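import Summits.AtomisticToContinuum.HydrodynamicLimit.Theorems.CollisionIsometryCLTCollisionalTransferLocalityJumpIncrements
import Summits.AtomisticToContinuum.HydrodynamicLimit.Theorems.CollisionIsometryCLTCollisionalTransferLocalityEquilibriumSup
import Literature.MathematicalPhysics.KineticTheory.EvenCollisionTubeFunctional
import HarnessLib

/-!
# Glue for the equilibrium rung of the crux, I: window domination of the collision virial and a burst lemma
(line `hemisphere-affine-slaving`, crux `CollisionalTransferLocality`, stmt-AtomisticToContinuum-9518)

Helper file (`--supports stmt-AtomisticToContinuum-9518`), the first of two modules re-landing the EQUILIBRIUM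
RUNG of the crux (`equilibriumRungFlow_unconditional`, module `…EquilibriumRungAssembly`, seat c8's p136415, which
bounced only because the gate restarted while it was in flight). Contents:

* `EqRungGlue.windowDomination` — [PW-a], the pathwise WINDOW DOMINATION of the weighted collision virial `V_N`
  (`virialW`) by the three trace even collision sums: with the cutoff `g(a) = max 0 (min 1 (2 − 2a/η_c))`, `χ ≡ 1`
  and the trace marks `Ξ^{kk} = evenMark k k`, on a GOOD orbit with the mollified ceiling `ρ_r(Φ_s z, ·) ≤ 2` on
  `[0, t]` and `4σ³ ≤ η_c`: (i) `0 ≤ K_k(τ) = collisionSum σ N (Φ N) τ 1 g Ξ^{kk} r z`; (ii) for `0 ≤ τ ≤ τ' ≤ t`,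
  `V_N(τ') − V_N(τ) ≤ (1 + 2L) Σ_k (K_k(τ') − K_k(τ)) + (N+1)⁻¹ Σ_{ordered collisions in (0,t], a speed > L} virialK`.
  This is the statement of the accepted module `…WindowDomination` (p132091, `stub_windowDomination`) minus its
  unused hypotheses (`σ ≤ 1/2`, `0 < r < 1/4`, `0 < t`); that module has never been built by the check farm, so the
  proof is re-derived here under new names (namespace `EqRungGlue`; the one-pair identity is stated σ-free, in terms
  of the unit normal `ω = omg`). Collision by collision: both sides are finite sums over the collision times in
  `(τ, τ']` of sums over the ordered contact pairs (`collisionPairSum_Ioc_split`,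
  `HardSphereFlow.collisionPairSum_eq_finsum_ite`, `Icc 0 τ' = Icc 0 τ ∪ Ioc τ τ'`); at an ordered contact pair
  `(i, j)` of the OUTGOING post-collisional configuration (`IsHardSphereTrajectory.isOutgoing_of_mem_contactSet`) the
  pre-collisional velocities `(v_i⁻, v_j⁻) = reflectVel n (v_i, v_j)` satisfy
  `⟪v_j⁻ − v_i⁻, ω⟫ = ⟪v_i − v_j, ω⟫ = ‖Δv_i‖ > 0`, so `Σ_k Ξ^{kk}(ω, v_i⁻, v_j⁻) = ‖Δv_i‖ ‖ω‖² = ‖Δv_i‖`, while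
  `g(σ³ρ_r(x_i)) = 1` under the ceiling; a collision with both speeds `≤ L` has
  `virialK = ε‖Δv_i‖(1 + ‖v_i‖ + ‖v_j‖) ≤ (1 + 2L) ε Σ_k Ξ^{kk}`, every other one is in the tail.
* `noBursts_of_virialLLN` — [WB]⟸[VL]: window-burst control of `V_N` on a grid from a fixed-time law of large numbers
  with a continuous limit (pure probability: uniform continuity of the limit + union bound over the grid times).
* `equilibriumRung_of_virialLLN` — the registered stub of seat c6 (v11, the [VL] route of the equilibrium rung): from
  the route item `MesoscopicLLN` (9524) and the landed `sup_τ` assembly [ER'] (`stub_equilibriumSup`, p133771), the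
  crux's conclusion at `(σ, 1, θ, 0, Φ)` follows from a fixed-time virial LLN with continuous limit at `(σ, Φ)`
  (`noBursts_of_virialLLN` + `conclusionAtFlow_iff`).
* `exists_uniform_radius`, `setIntegral_Icc_self_eq_zero` — two elementary lemmas used by the assembly (module II,
  `…EquilibriumRungAssembly`: `noVirialBurstsConst_of`, `constLLN_of`, `equilibriumRungFlow_unconditional`).

References: S. Chapman, T. G. Cowling, *The Mathematical Theory of Non-uniform Gases* (1970), Ch. 16 (collisional
transfer); C. Cercignani, R. Illner, M. Pulvirenti, *The Mathematical Theory of Dilute Gases* (1994), §4.2. All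
statements here are folklore bookkeeping; nothing probabilistic beyond a finite union bound.
-/

namespace Summit.AtomisticToContinuum.HydrodynamicLimit.Theorems.HemisphereAffineSlaving

open scoped BigOperators Topology Classical ENNReal InnerProductSpace
open Filter Set Function MeasureTheory

noncomputable section

open Literature.MathematicalPhysics.KineticTheory (T3 V3)
open Literature.Analysis.FunctionSpaces

namespace EqRungGlue

open Literature.Analysis.FluidPDE
open Literature.MathematicalPhysics.KineticTheory (hsDiameter hsDiameter_pos evenMark mollDensity collisionSum)

/-! ## One ordered contact pair -/

/-- **The trace of the even marks at an outgoing pair is the flux weight** (σ-free form, unit normal `ω = omg`).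
For an ordered pair `(i, j)` with `n = x_i − x_j ≠ 0` of an OUTGOING configuration (`⟪n, v_i − v_j⟫ > 0`) and the
pre-collisional velocities `(v_i⁻, v_j⁻) = reflectVel n (v_i, v_j)`: `Σ_k Ξ^{kk}(ω, v_i⁻, v_j⁻) = ‖Δv_i‖`
(`⟪v_j⁻ − v_i⁻, ω⟫ = ⟪v_i − v_j, ω⟫ = ‖Δv_i‖ ≥ 0` and `Σ_k ω_k² = ‖ω‖² = 1`). [folklore] -/
theorem sum_evenMark_diag_omg_eq_norm_dV {N : ℕ} {w : Cfg N} {i j : Fin (N + 1)}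
    (hn0 : sepV N w i j ≠ 0) (hout : 0 < ⟪sepV N w i j, (w i).2 - (w j).2⟫_ℝ) :
    ∑ k : Fin 3, evenMark k k (omg N w i j,
        (reflectVel (sepV N w i j) ((w i).2, (w j).2)).1,
        (reflectVel (sepV N w i j) ((w i).2, (w j).2)).2) = ‖dV N w i j‖ := by
  have hnpos : 0 < ‖sepV N w i j‖ := norm_pos_iff.2 hn0
  have hω1 : ‖omg N w i j‖ = 1 := norm_omg hn0
  set c : ℝ := ⟪(w i).2 - (w j).2, omg N w i j⟫_ℝ with hcdef
  have hc_eq : c = ‖sepV N w i j‖⁻¹ * ⟪sepV N w i j, (w i).2 - (w j).2⟫_ℝ := by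
    rw [hcdef, omg, inner_smul_right, real_inner_comm]
  have hcpos : 0 < c := by rw [hc_eq]; exact mul_pos (inv_pos.2 hnpos) hout
  have hdv : ‖dV N w i j‖ = c := by
    rw [norm_dV_eq hn0, ← hcdef, abs_of_pos hcpos]
  -- the reflection flips the normal component of the relative velocity
  have hrefl : ⟪(reflectVel (sepV N w i j) ((w i).2, (w j).2)).2 -
      (reflectVel (sepV N w i j) ((w i).2, (w j).2)).1, omg N w i j⟫_ℝ = c := by
    rw [omg, inner_smul_right, ← neg_sub (reflectVel (sepV N w i j) ((w i).2, (w j).2)).1, inner_neg_left,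
      real_inner_comm, inner_reflectVel_fst_sub_snd (sepV N w i j) hn0, neg_neg, hc_eq]
  -- `Σ_k ω_k² = ‖ω‖² = 1`
  have hsq : ∑ k : Fin 3, (omg N w i j) k * (omg N w i j) k = 1 := by
    have h := EuclideanSpace.norm_sq_eq (omg N w i j)
    rw [hω1, one_pow] at h
    rw [h]
    refine Finset.sum_congr rfl fun k _ => ?_
    rw [Real.norm_eq_abs, sq_abs, sq]
  simp only [evenMark]
  rw [hrefl, max_eq_left hcpos.le, ← Finset.mul_sum, hsq, mul_one, hdv]

/-- Under the ceiling `ρ ≤ 2` and `4σ³ ≤ η_c` (`0 < σ`) the cutoff argument satisfies `2·(σ³ρ) ≤ η_c`. [folklore] -/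
theorem two_mul_cube_mul_le_of_ceiling {σ ρ ηc : ℝ} (hσ : 0 < σ) (hρ : ρ ≤ 2) (hσc : 4 * σ ^ 3 ≤ ηc) :
    2 * (σ ^ 3 * ρ) ≤ ηc := by
  have hσ3 : 0 < σ ^ 3 := by positivity
  have h2 : σ ^ 3 * ρ ≤ σ ^ 3 * 2 := mul_le_mul_of_nonneg_left hρ hσ3.le
  linarith

/-- **The one-collision comparison.** For an ordered pair `(i, j)` at contact (`‖x_i − x_j‖ = ε_N`) of an outgoing
configuration `w`, when the cutoff argument satisfies `2σ³ρ_r(w, x_i) ≤ η_c` (so that `g(σ³ρ_r(x_i)) = 1`): the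
weighted virial kernel is at most `(1 + 2L)` times `ε_N Σ_k g(σ³ρ_r(x_i)) Ξ^{kk}(ε_N⁻¹ n, v_i⁻, v_j⁻)` plus the fast
tail `𝟙{‖v_i‖ > L ∨ ‖v_j‖ > L} virialK` (`0 < L`). [folklore] -/
theorem virialK_le_windowPair {σ : ℝ} (hσ : 0 < σ) {ηc r L : ℝ} (hηc : 0 < ηc) (hL : 0 < L)
    {N : ℕ} {w : Cfg N} {i j : Fin (N + 1)}
    (hcontact : ‖sepV N w i j‖ = hsDiameter σ N) (hout : 0 < ⟪sepV N w i j, (w i).2 - (w j).2⟫_ℝ)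
    (hg2 : 2 * (σ ^ 3 * mollDensity r w (w i).1) ≤ ηc) (s : ℝ) :
    virialK σ N s w i j ≤
      (1 + 2 * L) * (hsDiameter σ N * ∑ k : Fin 3,
        (1 : ℝ) * max 0 (min 1 (2 - 2 * (σ ^ 3 * mollDensity r w (w i).1) / ηc)) *
          evenMark k k ((hsDiameter σ N)⁻¹ • sepV N w i j,
            (reflectVel (sepV N w i j) ((w i).2, (w j).2)).1,
            (reflectVel (sepV N w i j) ((w i).2, (w j).2)).2)) +
      (if L < ‖(w i).2‖ ∨ L < ‖(w j).2‖ then virialK σ N s w i j else 0) := by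
  have hε : 0 < hsDiameter σ N := hsDiameter_pos hσ N
  have hn0 : sepV N w i j ≠ 0 := by
    intro h; rw [h, norm_zero] at hcontact; exact hε.ne hcontact
  have hω : (hsDiameter σ N)⁻¹ • sepV N w i j = omg N w i j := by rw [omg, hcontact]
  -- the cutoff is `1` under the ceiling
  have hg : max 0 (min 1 (2 - 2 * (σ ^ 3 * mollDensity r w (w i).1) / ηc)) = 1 := by
    have h1 : 2 * (σ ^ 3 * mollDensity r w (w i).1) / ηc ≤ 1 := (div_le_one hηc).2 hg2
    rw [min_eq_left (by linarith), max_eq_right zero_le_one]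
  simp only [hg, one_mul]
  rw [hω, sum_evenMark_diag_omg_eq_norm_dV hn0 hout]
  have hV0 : 0 ≤ virialK σ N s w i j := virialK_nonneg hσ.le N s w i j
  have hflux : 0 ≤ hsDiameter σ N * ‖dV N w i j‖ := by positivity
  by_cases hfast : L < ‖(w i).2‖ ∨ L < ‖(w j).2‖
  · rw [if_pos hfast]
    have h1 : 0 ≤ (1 + 2 * L) * (hsDiameter σ N * ‖dV N w i j‖) := by positivity
    linarith
  · rw [if_neg hfast, add_zero]
    push Not at hfast
    unfold virialK
    calc hsDiameter σ N * ‖dV N w i j‖ * (1 + ‖(w i).2‖ + ‖(w j).2‖)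
        ≤ hsDiameter σ N * ‖dV N w i j‖ * (1 + 2 * L) := by
          refine mul_le_mul_of_nonneg_left ?_ hflux
          linarith [hfast.1, hfast.2]
      _ = (1 + 2 * L) * (hsDiameter σ N * ‖dV N w i j‖) := by ring

/-! ## Window domination on a good orbit -/

/-- **[PW-a] Window domination of the weighted collision virial by the trace even collision sums** (the statement of
the accepted, never built `stub_windowDomination` of module `…WindowDomination`, p132091, without its unused hypotheses
`σ ≤ 1/2`, `0 < r < 1/4`, `0 < t`). Fix `σ > 0`, a cutoff level `η_c > 0`, `g(a) = max 0 (min 1 (2 − 2a/η_c))`, `χ ≡ 1`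
and the trace marks `Ξ^{kk} = evenMark k k`. For every radius `r`, every `L > 0`, flow family, `N`, GOOD initial datum
`z` and horizon `t` with the mollified ceiling `ρ_r(Φ_s z, x) ≤ 2` on `[0, t]` and `4σ³ ≤ η_c`:
(i) `0 ≤ K_k(τ) = collisionSum σ N (Φ N) τ 1 g Ξ^{kk} r z`; (ii) for `0 ≤ τ ≤ τ' ≤ t`,
`V_N(τ') − V_N(τ) ≤ (1 + 2L) Σ_k (K_k(τ') − K_k(τ)) + (N+1)⁻¹ Σ_{ordered collisions in (0,t], a speed > L} virialK`
(collision by collision on the good orbit: outgoing post-collisional pairs, `reflectVel` recovers the incoming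
velocities, `Σ_k Ξ^{kk}(ω, v_i⁻, v_j⁻) = ‖Δv_i‖`, `g(σ³ρ_r) = 1` under the ceiling). [folklore; Chapman–Cowling (1970) Ch. 16] -/
theorem windowDomination : ∀ (σ : ℝ), 0 < σ → ∀ (ηc : ℝ), 0 < ηc → ∀ (r L : ℝ), 0 < L →
    ∀ (Φ : Flows σ) (N : ℕ) (z : Cfg N), z ∈ (Φ N).good → ∀ t : ℝ,
    (∀ s ∈ Icc 0 t, ∀ x : T3, mollDensity r ((Φ N).flow s z) x ≤ 2) → 4 * σ ^ 3 ≤ ηc →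
    (∀ (k : Fin 3) (τ : ℝ), 0 ≤ collisionSum σ N (Φ N) τ (fun _ : ℝ × T3 => (1 : ℝ))
      (fun a : ℝ => max 0 (min 1 (2 - 2 * a / ηc))) (evenMark k k) r z) ∧
    (∀ τ τ' : ℝ, 0 ≤ τ → τ ≤ τ' → τ' ≤ t → virialW σ Φ N z τ' - virialW σ Φ N z τ ≤
      (1 + 2 * L) * ∑ k : Fin 3, (collisionSum σ N (Φ N) τ' (fun _ : ℝ × T3 => (1 : ℝ))
          (fun a : ℝ => max 0 (min 1 (2 - 2 * a / ηc))) (evenMark k k) r z -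
        collisionSum σ N (Φ N) τ (fun _ : ℝ × T3 => (1 : ℝ))
          (fun a : ℝ => max 0 (min 1 (2 - 2 * a / ηc))) (evenMark k k) r z) +
      ((N : ℝ) + 1)⁻¹ * (Φ N).collisionPairSum (Ioc 0 t)
        (fun s w i j => if L < ‖(w i).2‖ ∨ L < ‖(w j).2‖ then virialK σ N s w i j else 0) z) := by
  intro σ hσ ηc hηc r L hL Φ N z hz t hceil hσc
  have hε : 0 < hsDiameter σ N := hsDiameter_pos hσ N
  have htraj := (Φ N).isTrajectory z hz
  -- the kernel of `K_k` as a collision pair sum along the flow, and the fast tail kernel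
  set gK : Fin 3 → ℝ → Cfg N → Fin (N + 1) → Fin (N + 1) → ℝ := fun k s w i j =>
    (1 : ℝ) * max 0 (min 1 (2 - 2 * (σ ^ 3 * mollDensity r w (w i).1) / ηc)) *
      evenMark k k ((hsDiameter σ N)⁻¹ • sepV N w i j,
        (reflectVel (sepV N w i j) ((w i).2, (w j).2)).1,
        (reflectVel (sepV N w i j) ((w i).2, (w j).2)).2) with hgK
  set tailK : ℝ → Cfg N → Fin (N + 1) → Fin (N + 1) → ℝ := fun s w i j =>
    if L < ‖(w i).2‖ ∨ L < ‖(w j).2‖ then virialK σ N s w i j else 0 with htailK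
  have hgK0 : ∀ k s w i j, 0 ≤ gK k s w i j := fun k s w i j => by
    simp only [hgK, evenMark]
    exact mul_nonneg (mul_nonneg zero_le_one (le_max_left _ _)) (mul_nonneg (le_max_right _ _) (mul_self_nonneg _))
  have htailK0 : ∀ s w i j, 0 ≤ tailK s w i j := fun s w i j => by
    simp only [htailK]
    split_ifs
    · exact virialK_nonneg hσ.le N s w i j
    · exact le_rfl
  -- `K_k(τ) = ε/(N+1) · CPS(Icc 0 τ) gK_k`
  have hK : ∀ (k : Fin 3) (τ : ℝ),
      collisionSum σ N (Φ N) τ (fun _ : ℝ × T3 => (1 : ℝ)) (fun a : ℝ => max 0 (min 1 (2 - 2 * a / ηc)))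
        (evenMark k k) r z =
      hsDiameter σ N / ((N : ℝ) + 1) * (Φ N).collisionPairSum (Icc 0 τ) (gK k) z := by
    intro k τ
    rw [(Φ N).collisionPairSum_eq_finsum_ite hz]
    rfl
  -- window differences of `K_k`
  have hKdiff : ∀ (k : Fin 3) {τ τ' : ℝ}, 0 ≤ τ → τ ≤ τ' →
      collisionSum σ N (Φ N) τ' (fun _ : ℝ × T3 => (1 : ℝ)) (fun a : ℝ => max 0 (min 1 (2 - 2 * a / ηc)))
          (evenMark k k) r z -
        collisionSum σ N (Φ N) τ (fun _ : ℝ × T3 => (1 : ℝ)) (fun a : ℝ => max 0 (min 1 (2 - 2 * a / ηc)))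
          (evenMark k k) r z =
      hsDiameter σ N / ((N : ℝ) + 1) * (Φ N).collisionPairSum (Ioc τ τ') (gK k) z := by
    intro k τ τ' hτ hττ'
    have hdisj : Disjoint (Icc 0 τ) (Ioc τ τ') :=
      Set.disjoint_left.2 fun x hx1 hx2 => (not_lt.2 hx1.2) hx2.1
    rw [hK, hK]
    unfold HardSphereFlow.collisionPairSum
    rw [← Icc_union_Ioc_eq_Icc hτ hττ', collisionPairSum_union (htraj.locFinite 0 τ)
      (htraj.finite_collisionTimes_inter_Ioc τ τ') hdisj]
    ring
  refine ⟨fun k τ => ?_, fun τ τ' hτ hττ' hτ't => ?_⟩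
  · -- (i) nonnegativity
    rw [hK]
    refine mul_nonneg (div_nonneg hε.le (by positivity)) ?_
    unfold HardSphereFlow.collisionPairSum
    exact collisionPairSum_nonneg fun s i j => hgK0 k s _ i j
  · -- (ii) window domination
    have hc0 : (0 : ℝ) ≤ ((N : ℝ) + 1)⁻¹ := by positivity
    have hfin := htraj.finite_collisionTimes_inter_Ioc τ τ'
    -- the tail over `(τ, τ']` is part of the tail over `(0, t]`
    have htail : (Φ N).collisionPairSum (Ioc τ τ') tailK z ≤ (Φ N).collisionPairSum (Ioc 0 t) tailK z := by
      rw [collisionPairSum_Ioc_split Φ hz (hτ.trans hττ') hτ't tailK, collisionPairSum_Ioc_split Φ hz hτ hττ' tailK]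
      have h1 : 0 ≤ (Φ N).collisionPairSum (Ioc 0 τ) tailK z :=
        collisionPairSum_nonneg fun s i j => htailK0 s _ i j
      have h2 : 0 ≤ (Φ N).collisionPairSum (Ioc τ' t) tailK z :=
        collisionPairSum_nonneg fun s i j => htailK0 s _ i j
      linarith
    -- the window comparison, collision by collision
    have hmain : (Φ N).collisionPairSum (Ioc τ τ') (virialK σ N) z ≤
        (1 + 2 * L) * (hsDiameter σ N * ∑ k : Fin 3, (Φ N).collisionPairSum (Ioc τ τ') (gK k) z) +
          (Φ N).collisionPairSum (Ioc τ τ') tailK z := by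
      unfold HardSphereFlow.collisionPairSum
      simp only [collisionPairSum_eq_finset_sum hfin]
      have htime : ∀ tc ∈ hfin.toFinset,
          ∑ p ∈ contactPairs (Torus.geometry (Fin 3)) (hsDiameter σ N) ((Φ N).flow tc z),
              virialK σ N tc ((Φ N).flow tc z) p.1 p.2 ≤
            (1 + 2 * L) * (hsDiameter σ N * ∑ k : Fin 3,
              ∑ p ∈ contactPairs (Torus.geometry (Fin 3)) (hsDiameter σ N) ((Φ N).flow tc z),
                gK k tc ((Φ N).flow tc z) p.1 p.2) +
              ∑ p ∈ contactPairs (Torus.geometry (Fin 3)) (hsDiameter σ N) ((Φ N).flow tc z),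
                tailK tc ((Φ N).flow tc z) p.1 p.2 := by
        intro tc htc
        obtain ⟨-, htcI⟩ := (Set.Finite.mem_toFinset hfin).1 htc
        have hs : tc ∈ Icc 0 t := ⟨hτ.trans htcI.1.le, htcI.2.trans hτ't⟩
        calc ∑ p ∈ contactPairs (Torus.geometry (Fin 3)) (hsDiameter σ N) ((Φ N).flow tc z),
              virialK σ N tc ((Φ N).flow tc z) p.1 p.2
            ≤ ∑ p ∈ contactPairs (Torus.geometry (Fin 3)) (hsDiameter σ N) ((Φ N).flow tc z),
                ((1 + 2 * L) * (hsDiameter σ N * ∑ k : Fin 3, gK k tc ((Φ N).flow tc z) p.1 p.2) +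
                  tailK tc ((Φ N).flow tc z) p.1 p.2) := by
              refine Finset.sum_le_sum fun p hp => ?_
              obtain ⟨hne, hcs⟩ := mem_contactPairs.1 hp
              have hout : 0 < ⟪sepV N ((Φ N).flow tc z) p.1 p.2,
                  ((Φ N).flow tc z p.1).2 - ((Φ N).flow tc z p.2).2⟫_ℝ :=
                htraj.isOutgoing_of_mem_contactSet hne hcs
              have hcontact : ‖sepV N ((Φ N).flow tc z) p.1 p.2‖ = hsDiameter σ N := hcs.2
              exact virialK_le_windowPair hσ hηc hL hcontact hout
                (two_mul_cube_mul_le_of_ceiling hσ (hceil tc hs _) hσc) tc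
          _ = _ := by
              rw [Finset.sum_add_distrib, ← Finset.mul_sum, ← Finset.mul_sum, Finset.sum_comm]
      calc ∑ tc ∈ hfin.toFinset, ∑ p ∈ contactPairs (Torus.geometry (Fin 3)) (hsDiameter σ N) ((Φ N).flow tc z),
            virialK σ N tc ((Φ N).flow tc z) p.1 p.2
          ≤ ∑ tc ∈ hfin.toFinset, ((1 + 2 * L) * (hsDiameter σ N * ∑ k : Fin 3,
              ∑ p ∈ contactPairs (Torus.geometry (Fin 3)) (hsDiameter σ N) ((Φ N).flow tc z),
                gK k tc ((Φ N).flow tc z) p.1 p.2) +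
              ∑ p ∈ contactPairs (Torus.geometry (Fin 3)) (hsDiameter σ N) ((Φ N).flow tc z),
                tailK tc ((Φ N).flow tc z) p.1 p.2) := Finset.sum_le_sum htime
        _ = _ := by
            rw [Finset.sum_add_distrib, ← Finset.mul_sum, ← Finset.mul_sum, Finset.sum_comm]
    -- assemble
    have hsumK : ∑ k : Fin 3,
        (collisionSum σ N (Φ N) τ' (fun _ : ℝ × T3 => (1 : ℝ)) (fun a : ℝ => max 0 (min 1 (2 - 2 * a / ηc)))
            (evenMark k k) r z -
          collisionSum σ N (Φ N) τ (fun _ : ℝ × T3 => (1 : ℝ)) (fun a : ℝ => max 0 (min 1 (2 - 2 * a / ηc)))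
            (evenMark k k) r z) =
        hsDiameter σ N / ((N : ℝ) + 1) * ∑ k : Fin 3, (Φ N).collisionPairSum (Ioc τ τ') (gK k) z := by
      rw [Finset.mul_sum]
      exact Finset.sum_congr rfl fun k _ => hKdiff k hτ hττ'
    rw [hsumK, virialW, virialW, collisionPairSum_Ioc_split Φ hz hτ hττ' (virialK σ N)]
    have h1 := mul_le_mul_of_nonneg_left hmain hc0
    have h2 := mul_le_mul_of_nonneg_left htail hc0
    have hid : ((N : ℝ) + 1)⁻¹ * ((1 + 2 * L) * (hsDiameter σ N *
        ∑ k : Fin 3, (Φ N).collisionPairSum (Ioc τ τ') (gK k) z) + (Φ N).collisionPairSum (Ioc τ τ') tailK z) =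
        (1 + 2 * L) * (hsDiameter σ N / ((N : ℝ) + 1) * ∑ k : Fin 3, (Φ N).collisionPairSum (Ioc τ τ') (gK k) z) +
          ((N : ℝ) + 1)⁻¹ * (Φ N).collisionPairSum (Ioc τ τ') tailK z := by
      ring
    linarith

end EqRungGlue

/-! ## Window bursts from a fixed-time law of large numbers -/

/-- [WB]⟸[VL] **Window-burst control from a fixed-time law of large numbers** (pure probability). At any
`(σ, profiles, Φ)` and horizon `t > 0`: if `V_N(τ) → Λ(τ)` in probability at each `τ ∈ [0, t]` with `Λ` continuous on
`[0, t]`, then for all `δ, ε > 0` there is a grid size `n > 0` such that, eventually in `N`, the probability that some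
window increment `V_N((k+1)t/n) − V_N(kt/n)`, `k < n`, exceeds `δ` is at most `ε` (uniform continuity of `Λ`, triangle
inequality at the two grid ends, union bound over the `n + 1` grid times). [folklore] -/
theorem noBursts_of_virialLLN (σ : ℝ) (a₀ θ₀ : T3 → ℝ) (u₀ : T3 → V3) (Φ : Flows σ) {t : ℝ} (ht : 0 < t)
    (hVL : ∃ Λ : ℝ → ℝ, ContinuousOn Λ (Icc 0 t) ∧ ∀ τ ∈ Icc 0 t, ∀ δ : ℝ, 0 < δ → Tendsto (fun N : ℕ =>
      Literature.MathematicalPhysics.KineticTheory.localGibbsLaw σ a₀ u₀ θ₀ N (Φ N) {z | δ < |virialW σ Φ N z τ - Λ τ|}) atTop (𝓝 0)) :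
    ∀ δ ε : ℝ, 0 < δ → 0 < ε → ∃ n : ℕ, 0 < n ∧ ∀ᶠ N : ℕ in atTop,
      Literature.MathematicalPhysics.KineticTheory.localGibbsLaw σ a₀ u₀ θ₀ N (Φ N) {z | ∃ k : ℕ, k < n ∧
        δ < virialW σ Φ N z ((k + 1) * (t / n)) - virialW σ Φ N z (k * (t / n))} ≤ ENNReal.ofReal ε := by
  intro δ ε hδ hε
  obtain ⟨Λ, hΛc, hΛ⟩ := hVL
  have huc : UniformContinuousOn Λ (Icc 0 t) := isCompact_Icc.uniformContinuousOn_of_continuous hΛc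
  rw [Metric.uniformContinuousOn_iff] at huc
  obtain ⟨ρ, hρ, hρΛ⟩ := huc (δ / 3) (by positivity)
  obtain ⟨n, hn⟩ := exists_nat_gt (t / ρ)
  have htρ : 0 < t / ρ := div_pos ht hρ
  have hnR : (0 : ℝ) < n := htρ.trans hn
  have hn0 : 0 < n := by exact_mod_cast hnR
  have hmesh : t / n < ρ := by
    rw [div_lt_iff₀ hnR]
    calc t = t / ρ * ρ := by field_simp
      _ < n * ρ := by gcongr
      _ = ρ * n := mul_comm _ _
  refine ⟨n, hn0, ?_⟩
  set P : (N : ℕ) → Measure (Cfg N) := fun N => Literature.MathematicalPhysics.KineticTheory.localGibbsLaw σ a₀ u₀ θ₀ N (Φ N) with hP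
  have hgrid : ∀ k : ℕ, k ≤ n → (k : ℝ) * (t / n) ∈ Icc 0 t := by
    intro k hk
    refine ⟨by positivity, ?_⟩
    have hk' : (k : ℝ) ≤ n := by exact_mod_cast hk
    calc (k : ℝ) * (t / n) ≤ n * (t / n) := by gcongr
      _ = t := by field_simp
  set A : (N : ℕ) → Fin (n + 1) → Set (Cfg N) := fun N k =>
    {z | δ / 3 < |virialW σ Φ N z ((k : ℕ) * (t / n)) - Λ ((k : ℕ) * (t / n))|} with hA
  have hev : ∀ k : Fin (n + 1), Tendsto (fun N => P N (A N k)) atTop (𝓝 0) :=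
    fun k => hΛ _ (hgrid k (Nat.lt_succ_iff.mp k.2)) (δ / 3) (by positivity)
  have hsum : Tendsto (fun N => ∑ k : Fin (n + 1), P N (A N k)) atTop (𝓝 0) := by
    simpa using tendsto_finsetSum Finset.univ fun k _ => hev k
  have hε' : (0 : ℝ≥0∞) < ENNReal.ofReal ε := ENNReal.ofReal_pos.2 hε
  filter_upwards [(tendsto_order.1 hsum).2 _ hε'] with N hN
  refine le_trans (measure_mono ?_) ((measure_iUnion_fintype_le (P N) (A N)).trans hN.le)
  rintro z ⟨k, hk, hzk⟩
  simp only [Set.mem_iUnion]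
  by_contra hno
  push Not at hno
  have h1 : ¬ (δ / 3 < |virialW σ Φ N z ((k : ℕ) * (t / n)) - Λ ((k : ℕ) * (t / n))|) := by
    simpa [hA] using hno ⟨k, by omega⟩
  have h2 : ¬ (δ / 3 < |virialW σ Φ N z (((k + 1 : ℕ) : ℕ) * (t / n)) - Λ (((k + 1 : ℕ) : ℕ) * (t / n))|) := by
    simpa [hA] using hno ⟨k + 1, by omega⟩
  push_cast at h1 h2
  rw [not_lt] at h1 h2
  have hΛk : dist (Λ (((k : ℝ) + 1) * (t / n))) (Λ ((k : ℝ) * (t / n))) < δ / 3 := by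
    refine hρΛ _ ?_ _ (hgrid k (by omega)) ?_
    · exact_mod_cast hgrid (k + 1) (by omega)
    · rw [Real.dist_eq, show ((k : ℝ) + 1) * (t / n) - k * (t / n) = t / n by ring, abs_of_pos (by positivity)]
      exact hmesh
  rw [Real.dist_eq] at hΛk
  have e1 := (abs_le.mp h1).1
  have e2 := (abs_le.mp h2).2
  have e3 := (abs_lt.mp hΛk).2
  linarith

/-- A uniform positive radius over finitely many indices: if for each `m : Fin n` (`n > 0`) some `r₀(m) > 0` works for
all `r < r₀(m)`, then one `r₀ > 0` works for all `m` (the minimum). [folklore] -/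
theorem exists_uniform_radius {n : ℕ} (hn : 0 < n) {Q : Fin n → ℝ → Prop}
    (h : ∀ m : Fin n, ∃ r₀ : ℝ, 0 < r₀ ∧ ∀ r : ℝ, 0 < r → r < r₀ → Q m r) :
    ∃ r₀ : ℝ, 0 < r₀ ∧ ∀ m : Fin n, ∀ r : ℝ, 0 < r → r < r₀ → Q m r := by
  classical
  choose rr hrr Hrr using h
  haveI : Nonempty (Fin n) := Fin.pos_iff_nonempty.mp hn
  refine ⟨Finset.univ.inf' Finset.univ_nonempty rr, (Finset.lt_inf'_iff _).2 fun m _ => hrr m,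
    fun m r hr hrlt => Hrr m r hr (hrlt.trans_le (Finset.inf'_le _ (Finset.mem_univ m)))⟩

/-- A set integral over the degenerate interval `[0, 0]` vanishes. [folklore] -/
theorem setIntegral_Icc_self_eq_zero (f : ℝ → ℝ) : ∫ s in Icc (0 : ℝ) 0, f s = 0 := by
  rw [Set.Icc_self, Measure.restrict_singleton]
  simp

/-! ## The equilibrium rung from a fixed-time virial law of large numbers (registered stub of seat c6) -/

/-- **Registered stub `equilibriumRung_of_virialLLN` (seat c6, v11: the [VL] route of the equilibrium rung).** From the
route item `MesoscopicLLN` (9524) by name and the landed `sup_τ` assembly [ER'] (`stub_equilibriumSup`, p133771): for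
every `θ > 0` there is `σ₀ > 0` (`:= σ_[ER']`) such that for `0 < σ < σ₀` and every flow family `Φ`, IF at every horizon
`t > 0` the weighted collision virial `V_N(τ)` converges in probability at each fixed `τ ∈ [0, t]` to a limit `Λ`
continuous on `[0, t]` (the fixed-time virial LLN [VL] at `(σ, Φ)`), THEN the crux's conclusion holds at
`(σ, 1, θ, 0, Φ)`: the window bursts of `V_N` are excluded by `noBursts_of_virialLLN`, and the conclusion is the crux's
`let`-telescope (`conclusionAtFlow_iff`). [folklore assembly] -/
theorem equilibriumRung_of_virialLLN : Summit.AtomisticToContinuum.HydrodynamicLimit.Theses.StiffCollisionalRelaxation.MesoscopicLLN → ∀ θ : ℝ, 0 < θ → ∃ σ₀ : ℝ, 0 < σ₀ ∧ ∀ σ : ℝ, 0 < σ → σ < σ₀ → ∀ Φ : Flows σ, (∀ t : ℝ, 0 < t → ∃ Λ : ℝ → ℝ, ContinuousOn Λ (Icc 0 t) ∧ ∀ τ ∈ Icc 0 t, ∀ δ : ℝ, 0 < δ → Tendsto (fun N : ℕ => Literature.MathematicalPhysics.KineticTheory.localGibbsLaw σ (fun _ => 1) (fun _ => 0) (fun _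 => θ) N (Φ N) {z | δ < |virialW σ Φ N z τ - Λ τ|}) atTop (𝓝 0)) → ConclusionAtFlow σ (fun _ => 1) (fun _ => θ) (fun _ => 0) Φ := by
  intro hMeso θ hθ
  obtain ⟨σS, hσS, HS⟩ := stub_equilibriumSup hMeso θ hθ
  refine ⟨σS, hσS, fun σ hσ hlt Φ hVL => ?_⟩
  rw [conclusionAtFlow_iff]
  intro γ C φ hγ hγ' hadm t ht ψ χ hψ hχ
  exact HS σ hσ hlt Φ t ht (noBursts_of_virialLLN σ (fun _ => 1) (fun _ => θ) (fun _ => 0) Φ ht (hVL t ht))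
    γ C φ hγ hγ' hadm ψ χ hψ hχ

end

end Summit.AtomisticToContinuum.HydrodynamicLimit.Theorems.HemisphereAffineSlaving
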